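import Summits.ResolutionOfSingularities.ResolutionOfSingularities.Theorems.WeightedInvariantHypersurfaceLocalGameEFT4SDimOneGameRad
import Summits.ResolutionOfSingularities.ResolutionOfSingularities.Theorems.WeightedInvariantHypersurfaceLocalGameEFT4SDimOne
import HarnessLib

/-!
# The DIM-1 RUNG of the registered key H2a⁗-S `LocalWeightedDropEFT4S p` (door `HypersurfaceCentreConstruction`,
# stmt-ResolutionOfSingularities-19897), part 3: the ∀-model open presentation (open″) at the CLOSED positions of Krull
# dimension one for the ADOPTED concrete pair `(iotaOrd, (g, m) ↦ (√(g))ᵐ)`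

Topic: `Summits/ResolutionOfSingularities/ResolutionOfSingularities/Theorems`. Helper for the door item
`HypersurfaceCentreConstruction` (stmt-ResolutionOfSingularities-19897, route `WeightedInvariant`), ORDER (o23)(b) of the door
registrar res-L1-w43-plan-1 (2026-08-27T06:29:38Z) with RULINGS gen 8 #1 (ii) (06:53:45Z: `ι = iotaOrd`, `J := (√(F))ᵐ`, adopting
res-type-061). Part 2 (`…LocalGameEFT4SDimOne.lean`) proved (open″) at the closed dim-1 positions for every `ι` and every `J` that is
`𝔪ᵐ` at the non-zero non-units of DVRs; part 1b (`…LocalGameEFT4SDimOneGameRad.lean`, p510636) showed that the adopted `J` qualifies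
(`jRad_eq_pow_maximalIdeal`). This file is the one-line instantiation, filed separately so that parts 1b/2 depended on served oleans
only. [OURS · L1 W4.3] Replaces the role of NO printed item; NOT a statement of the manuscript [claim: Hironaka2017, status:
under-review]. AI work, weaker than expert review.
-/

noncomputable section

open IsLocalRing Literature.AlgebraicGeometry.Resolution
open Summit.ResolutionOfSingularities.ResolutionOfSingularities.Cruxes.HypersurfaceCentreConstruction.LocalEngine

set_option linter.dupNamespace false -- mandated namespace of this single-conjunct summit

namespace Summit.ResolutionOfSingularities.ResolutionOfSingularities.Theorems

/-- **(o23)(b) for the concrete pair** `(ι, J) = (iotaOrd, (g, m) ↦ (√(g))ᵐ)`: the (open″) ∀-model open presentation at every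
CLOSED position of Krull dimension `1` of a finite-type model over a perfect field of characteristic `p`.
[OURS · L1 W4.3 · (o23)(b)] -/
theorem jOpenPresentationForallSing_dimOne_iotaOrd (p : ℕ)
    (k₀ : Type) [Field k₀] [CharP k₀ p] [PerfectField k₀]
    (A : Type) [CommRing A] [Algebra k₀ A] [Algebra.FiniteType k₀ A] (𝔪 : Ideal A) [𝔪.IsPrime] (F : A)
    (hmax : 𝔪.IsMaximal) (hreg : IsRegularLocalRing (Localization.AtPrime 𝔪))
    (hdim : ringKrullDim (Localization.AtPrime 𝔪) = 1)
    (hF0 : algebraMap A (Localization.AtPrime 𝔪) F ≠ 0)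
    (hF2 : algebraMap A (Localization.AtPrime 𝔪) F ∈ (maximalIdeal (Localization.AtPrime 𝔪)) ^ 2) :
    ∃ h : A, h ∉ 𝔪 ∧ ∃ (N : ℕ) (U : Fin N → A) (W : Fin N → ℕ), (∀ i, 0 < W i) ∧
      (∃ hU : ∀ i, algebraMap A (Localization.AtPrime 𝔪) (U i) ∈ maximalIdeal (Localization.AtPrime 𝔪),
        LinearIndependent (ResidueField (Localization.AtPrime 𝔪))
          (fun i => ((maximalIdeal (Localization.AtPrime 𝔪)).toCotangent ⟨_, hU i⟩ :
            CotangentSpace (Localization.AtPrime 𝔪)))) ∧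
      ∀ (𝔮 : Ideal A) [𝔮.IsPrime], h ∉ 𝔮 →
        ((∀ i, U i ∈ 𝔮) ↔
          (algebraMap A (Localization.AtPrime 𝔮) F ∈ (maximalIdeal (Localization.AtPrime 𝔮)) ^ 2 ∧
            iotaOrd (Localization.AtPrime 𝔮) (algebraMap A (Localization.AtPrime 𝔮) F) =
              iotaOrd (Localization.AtPrime 𝔪) (algebraMap A (Localization.AtPrime 𝔪) F))) ∧
        ((∀ i, U i ∈ 𝔮) → ∀ m : ℕ,
          ((Ideal.span {algebraMap A (Localization.AtPrime 𝔮) F}).radical) ^ m =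
            (weightedMonomialIdeal U W m).map (algebraMap A (Localization.AtPrime 𝔮))) :=
  jOpenPresentationForallSing_dimOne p iotaOrd (fun (R : Type) _ (g : R) (m : ℕ) => ((Ideal.span {g}).radical) ^ m)
    jRad_eq_pow_maximalIdeal k₀ A 𝔪 F hmax hreg hdim hF0 hF2

end Summit.ResolutionOfSingularities.ResolutionOfSingularities.Theorems

end
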